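import Summits.ResolutionOfSingularities.ResolutionOfSingularities.Theorems.MarkedTransferCampaignW46MohWindowSurfaceCubeNormalForm
import Summits.ResolutionOfSingularities.ResolutionOfSingularities.Theorems.MarkedTransferCampaignW46MohWindowSurfaceCentreChild
import Summits.ResolutionOfSingularities.ResolutionOfSingularities.Theorems.MarkedTransferCampaignW46CuspStaircaseFibre
import Literature.AlgebraicGeometry.Resolution.NearPointsPointCentreUnique
import HarnessLib

/-!
# [OURS · L1 W4.6 rung (iii-2), `p = 2`] Surface Moh window — FIBRE UNIQUENESS: over an admitted centre the transform has at
# most ONE singular point (cell res-hironaka, LADDER-RESOLUTION rung L, D-0089; seat res-L1-s46-pv-5 gen 5; host MarkedTransfer,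
# `--supports stmt-ResolutionOfSingularities-16155 --as helper`; statement file `…CampaignW46MohWindowSurface.lean`)

HONEST FRAMING. Nothing here is a statement of H. Hironaka's manuscript [Hironaka2017] and nothing here asserts that any
statement of it holds. THEOREMS about the OURS regime `CampaignW46.Regime.mohWindowSurface` (o1 §5) at `p = 2`, step (F1) of the
EXIT-BOUND FORM `MohWindowSurfaceInsepFinLocalExitBound 2 K` (o1 §3): the singular locus of the transform over an admitted centre
is a single point. Inputs: the cube normal form of the centre (`…CubeNormalForm.lean`, on `…CubeCentre.lean`), the tree's blow-up
chart library — ONE family of charts for all points over the centre (`IsBlowup.exists_chartFamily`, res-L1-s46-pv-3,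
[CossartPiltant2008] Lemma 4.3 (3) pattern; `exists_stalk_ringHom_of_chart`; `isRsopPart_chartFamily_reesChart`) — and this seat's
origin-uniqueness `Cusp.chartPrime_eq_of_forall_mem` (`…CuspStaircaseFibre.lean`, [StacksProject] Tag 0BIQ). AI-written; AI review
is weaker than expert review. No `sorry`; axioms standard.

WHAT IS PROVED.
* `MohWindowSurface.chart_eq_zero_of_normalForm` (ring level, any characteristic): for a window presentation in CUBE NORMAL FORM
  `J = (z² + Σ_{k ≤ 3} a_k x^{3−k} y^k)`, `a₃` a unit, `a₀, a₁, a₂ ∈ 𝔪`, over a regular local ring of embedding dimension `3`, a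
  prime `𝔴` of the Rees chart `i` over `𝔪` at which the controlled transform `(J𝒪 : (c_i)²)` is SINGULAR (`⊆ 𝔪²`) is necessarily
  in the chart `i = 0` (`t = x`) and contains the two other chart generators `y/x`, `z/x` — it is THE ORIGIN of the `x`-chart
  (charts `y` and `z`: the transform has order `≤ 1`, resp. is the unit ideal).
* `MohWindowSurface.chartIndex_eq_zero_of_le_two` (scheme level, any chart presentation through a point over the centre).
* `eq_of_mem_sing_of_over_centre` — **FIBRE UNIQUENESS at `p = 2`**: for a §2.1-permissible blow-up of a state of
  `Regime.mohWindowSurface` whose transform is again in the regime, any two singular points of the transform over the centre are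
  EQUAL. With `…CentreChild.lean` / `…PureChildStep.lean` / `…Freeze.lean`: every admitted centre has at most one singular child,
  of strictly smaller weight — so the number of blow-ups is bounded (successor file `…ExitBoundTwo.lean`).
[ZariskiSamuel1960] [Matsumura1987] [CossartPiltant2008] [StacksProject]
-/

noncomputable section

set_option linter.dupNamespace false -- mandated namespace of this single-conjunct summit

open CategoryTheory AlgebraicGeometry TopologicalSpace IsLocalRing

namespace Summit.ResolutionOfSingularities.ResolutionOfSingularities.Theorems

namespace CampaignW46

open Literature.AlgebraicGeometry.Resolution
open Literature.AlgebraicGeometry.Hironaka2017.S02Preliminaries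
open Literature.AlgebraicGeometry.Hironaka2017.Datum
open Literature.AlgebraicGeometry.Hironaka2017.S16Proof
open Scheme.IdealSheafData

universe u

namespace MohWindowSurface

/-! ## 1. Ring level: a singular prime of a chart over a cube-normal-form centre is the origin of the chart `x` -/

/-- **[OURS · L1 W4.6 rung (iii-2)] A SINGULAR POINT OVER A CENTRE IN CUBE NORMAL FORM IS THE ORIGIN OF THE `x`-CHART** (ring level,
any characteristic). `R` regular local of embedding dimension `3` with regular system of parameters `c = (x, y, z)`; window
generator `g = z² + Σ_{k ≤ 3} a_k x^{3−k} y^k` in cube normal form (`a₃` a unit, `a₀, a₁, a₂ ∈ 𝔪`); `𝔴` a prime of the Rees chart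
ring `B_i = R[𝔪/c_i]` over `𝔪`, `L = (B_i)_𝔴`, `ψ : R → L` the structure map. If the controlled transform
`I′ = ((ψ g) : (ψ c_i)²) ⊆ 𝔪_L²` (the point is singular for exponent `2`), then `i = 0` and `c_l / c_0 ∈ 𝔴` for `l = 1, 2`.
Chart `z`: `I′ = (1 + z·S) = L`. Chart `y`: `I′ = (Z² + y·S)` with `S ≡ a₃` a unit, of order `≤ 1`. Chart `x`: `I′ = (Z² + x·S)`,
`S = a₀ + a₁E + a₂E² + a₃E³`; `I′ ⊆ 𝔪²` forces `Z ∈ 𝔪` and `S ∈ 𝔪`, whence `E³ ∈ 𝔪`, `E ∈ 𝔪`. NOT a statement of the manuscript.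
[folklore] -/
theorem chart_eq_zero_of_normalForm {R : Type u} [CommRing R] [IsRegularLocalRing R]
    (h3 : (maximalIdeal R).spanFinrank = 3) (c : Fin 3 → R) (hc : Ideal.span (Set.range c) = maximalIdeal R)
    (a : ℕ → R) (ha3 : IsUnit (a 3)) (ha : ∀ j < 3, a j ∈ maximalIdeal R)
    (i : Fin 3) (𝔴 : Ideal (chartRing c i)) [𝔴.IsPrime] (h𝔴 : 𝔴.comap (chartBase c i) = maximalIdeal R)
    (L : Type u) [CommRing L] [IsLocalRing L] [Algebra (chartRing c i) L] [IsLocalization.AtPrime L 𝔴]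
    (ψ : R →+* L) (hψ : ∀ r, ψ r = (algebraMap (chartRing c i) L : chartRing c i →+* L) (chartBase c i r))
    (hsing : Submodule.colon (Ideal.span {ψ (c 2 ^ 2 + ∑ k ∈ Finset.range (3 + 1), a k * c 0 ^ (3 - k) * c 1 ^ k)})
      ((Ideal.span {ψ (c i)} ^ 2 : Ideal L) : Set L) ≤ maximalIdeal L ^ 2) :
    i = 0 ∧ ∀ l, l ≠ i → chartGen c i l ∈ 𝔴 := by
  classical
  set alg : chartRing c i →+* L := (algebraMap (chartRing c i) L : chartRing c i →+* L) with halg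
  -- `L` is regular, `t = ψ (c i)` is a regular parameter
  have hz0 : Ideal.span (Set.range (Fin.append c (fun k : Fin 0 => Fin.elim0 k : Fin 0 → R))) = maximalIdeal R := by
    rw [span_range_append_elim0]; exact hc
  have hd0 : (maximalIdeal R).spanFinrank = 3 + 0 := by rw [h3]
  have hrsop := isRsopPart_chartFamily_reesChart c i (fun k : Fin 0 => Fin.elim0 k) hz0 hd0 𝔴 h𝔴 L
    (a := 0) (fun k : Fin 0 => Fin.elim0 k) (Function.injective_of_subsingleton _) (fun k => Fin.elim0 k)
  haveI hLreg : IsRegularLocalRing L := hrsop.isRegularLocalRing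
  haveI : IsDomain L := isDomain_of_isRegularLocalRing L
  set t : L := ψ (c i) with htdef
  have ht : t ∈ maximalIdeal L := by
    have h0 := hrsop.mem_maximalIdeal 0
    rw [htdef, hψ]; simpa only [chartFamily, Fin.cons_zero] using h0
  have ht0 : t ≠ 0 := by
    have h0 := hrsop.ne_zero 0
    rw [htdef, hψ]; simpa only [chartFamily, Fin.cons_zero] using h0
  have ht2 : t ∉ maximalIdeal L ^ 2 := by
    have h0 := hrsop.not_mem_sq 0
    rw [htdef, hψ]; simpa only [chartFamily, Fin.cons_zero] using h0
  -- `ψ` is local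
  have hψm : ∀ r ∈ maximalIdeal R, ψ r ∈ maximalIdeal L := fun r hr => by
    rw [hψ]
    exact (IsLocalization.AtPrime.to_map_mem_maximal_iff _ 𝔴 _).mpr (by rw [← Ideal.mem_comap, h𝔴]; exact hr)
  have hψa3 : IsUnit (ψ (a 3)) := ha3.map ψ
  -- chart relations
  have hrel : ∀ l, ψ (c l) = t * alg (chartGen c i l) := fun l => by
    rw [htdef, hψ, hψ, halg, ← map_mul, ← reesChartBase_apply_eq_mul_chartGen c i l]
  -- the cofactor `G` of `ψ g = t² · G` lies in `𝔪²`
  have hGm2 : ∀ G : L, ψ (c 2 ^ 2 + ∑ k ∈ Finset.range (3 + 1), a k * c 0 ^ (3 - k) * c 1 ^ k) = t ^ 2 * G →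
      G ∈ maximalIdeal L ^ 2 := by
    intro G hG
    have h1 : Submodule.colon (Ideal.span {ψ (c 2 ^ 2 + ∑ k ∈ Finset.range (3 + 1), a k * c 0 ^ (3 - k) * c 1 ^ k)})
        ((Ideal.span {ψ (c i)} ^ 2 : Ideal L) : Set L) = Ideal.span {G} := by
      rw [hG, ← htdef, colon_span_pow_mul (mem_nonZeroDivisors_of_ne_zero ht0)]
    exact hsing (h1 ▸ Ideal.mem_span_singleton_self G)
  -- membership transfer `𝔪_L → 𝔴`
  have hmem𝔴 : ∀ l, alg (chartGen c i l) ∈ maximalIdeal L → chartGen c i l ∈ 𝔴 := fun l hl =>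
    (IsLocalization.AtPrime.to_map_mem_maximal_iff _ 𝔴 _).mp hl
  -- which chart?
  obtain rfl | rfl | rfl : i = 0 ∨ i = 1 ∨ i = 2 := by
    rcases i with ⟨i, hi⟩
    have : i = 0 ∨ i = 1 ∨ i = 2 := by omega
    rcases this with rfl | rfl | rfl
    · exact Or.inl rfl
    · exact Or.inr (Or.inl rfl)
    · exact Or.inr (Or.inr rfl)
  · -- chart `x`: the origin
    set E : L := alg (chartGen c 0 1) with hE
    set Z : L := alg (chartGen c 0 2) with hZ
    set S : L := ∑ k ∈ Finset.range (3 + 1), ψ (a k) * E ^ (min k 3) with hS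
    have hfac := map_window_eq_chart ψ (hrel 1) (hrel 2) (show 2 ≤ 3 by norm_num) a (fun k => min k 3)
      (fun k => min_le_right k 3)
    rw [← window_sum_chart_zero, show 3 - 2 = 1 from rfl, pow_one] at hfac
    have hG := hGm2 (Z ^ 2 + t * S) hfac
    -- `Z ∈ 𝔪`
    have hZm : Z ∈ maximalIdeal L := by
      have h1 : Z ^ 2 ∈ maximalIdeal L := by
        have := Ideal.sub_mem _ (Ideal.pow_le_self two_ne_zero hG) (Ideal.mul_mem_right _ _ ht : t * S ∈ maximalIdeal L)
        rwa [add_sub_cancel_right] at this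
      exact (maximalIdeal.isMaximal L).isPrime.mem_of_pow_mem 2 h1
    -- `S ∈ 𝔪`
    have hSm : S ∈ maximalIdeal L := by
      by_contra hSm
      have hSu : IsUnit S := by
        by_contra h; exact hSm ((mem_maximalIdeal _).mpr (mem_nonunits_iff.mpr h))
      have h1 : t * S ∈ maximalIdeal L ^ 2 := by
        have := Ideal.sub_mem _ hG (Ideal.pow_mem_pow hZm 2)
        rwa [add_sub_cancel_left] at this
      have h2 : S * t ^ 1 ∈ maximalIdeal L ^ (1 + 1) := by rw [pow_one, mul_comm]; exact h1
      exact unit_mul_pow_not_mem_pow_succ ht2 hSu 1 h2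
    -- `E ∈ 𝔪`
    have hS' : S = (ψ (a 0) + ψ (a 1) * E + ψ (a 2) * E ^ 2) + ψ (a 3) * E ^ 3 := by
      rw [hS]
      simp only [Finset.sum_range_succ, Finset.sum_range_zero]
      norm_num
    have hlow : ψ (a 0) + ψ (a 1) * E + ψ (a 2) * E ^ 2 ∈ maximalIdeal L :=
      Ideal.add_mem _ (Ideal.add_mem _ (hψm _ (ha 0 (by norm_num)))
        (Ideal.mul_mem_right _ _ (hψm _ (ha 1 (by norm_num)))))
        (Ideal.mul_mem_right _ _ (hψm _ (ha 2 (by norm_num))))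
    have hE3 : E ^ 3 ∈ maximalIdeal L := by
      have h1 : ψ (a 3) * E ^ 3 ∈ maximalIdeal L := by
        have := Ideal.sub_mem _ hSm hlow
        rwa [hS', add_sub_cancel_left] at this
      exact (Ideal.unit_mul_mem_iff_mem _ hψa3).mp h1
    have hEm : E ∈ maximalIdeal L := (maximalIdeal.isMaximal L).isPrime.mem_of_pow_mem 3 hE3
    refine ⟨rfl, fun l hl => ?_⟩
    obtain rfl | rfl : l = 1 ∨ l = 2 := by
      rcases l with ⟨l, hl'⟩
      have : l = 0 ∨ l = 1 ∨ l = 2 := by omega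
      rcases this with rfl | rfl | rfl
      · exact absurd rfl hl
      · exact Or.inl rfl
      · exact Or.inr rfl
    · exact hmem𝔴 1 hEm
    · exact hmem𝔴 2 hZm
  · -- chart `y`: order `≤ 1`
    exfalso
    set E : L := alg (chartGen c 1 0) with hE
    set Z : L := alg (chartGen c 1 2) with hZ
    set S : L := ∑ k ∈ Finset.range (3 + 1), ψ (a k) * E ^ (3 - k) with hS
    have hfac := map_window_eq_chart ψ (hrel 0) (hrel 2) (show 2 ≤ 3 by norm_num) a (fun k => 3 - k)
      (fun k => Nat.sub_le 3 k)
    rw [← window_sum_chart_one, show 3 - 2 = 1 from rfl, pow_one] at hfac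
    have hG := hGm2 (Z ^ 2 + t * S) hfac
    have hZm : Z ∈ maximalIdeal L := by
      have h1 : Z ^ 2 ∈ maximalIdeal L := by
        have := Ideal.sub_mem _ (Ideal.pow_le_self two_ne_zero hG) (Ideal.mul_mem_right _ _ ht : t * S ∈ maximalIdeal L)
        rwa [add_sub_cancel_right] at this
      exact (maximalIdeal.isMaximal L).isPrime.mem_of_pow_mem 2 h1
    -- `S` is a unit
    have hS' : S = ψ (a 3) + (ψ (a 0) * E ^ 3 + ψ (a 1) * E ^ 2 + ψ (a 2) * E) := by
      rw [hS]
      simp only [Finset.sum_range_succ, Finset.sum_range_zero]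
      norm_num
      ring
    have hlow : ψ (a 0) * E ^ 3 + ψ (a 1) * E ^ 2 + ψ (a 2) * E ∈ maximalIdeal L :=
      Ideal.add_mem _ (Ideal.add_mem _ (Ideal.mul_mem_right _ _ (hψm _ (ha 0 (by norm_num))))
        (Ideal.mul_mem_right _ _ (hψm _ (ha 1 (by norm_num)))))
        (Ideal.mul_mem_right _ _ (hψm _ (ha 2 (by norm_num))))
    have hSu : IsUnit S := by
      by_contra h
      have hSm : S ∈ maximalIdeal L := (mem_maximalIdeal _).mpr (mem_nonunits_iff.mpr h)
      have : ψ (a 3) ∈ maximalIdeal L := by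
        have := Ideal.sub_mem _ hSm hlow
        rwa [hS', add_sub_cancel_right] at this
      exact (maximalIdeal.isMaximal L).ne_top (Ideal.eq_top_of_isUnit_mem _ this hψa3)
    have h1 : t * S ∈ maximalIdeal L ^ 2 := by
      have := Ideal.sub_mem _ hG (Ideal.pow_mem_pow hZm 2)
      rwa [add_sub_cancel_left] at this
    have h2 : S * t ^ 1 ∈ maximalIdeal L ^ (1 + 1) := by rw [pow_one, mul_comm]; exact h1
    exact unit_mul_pow_not_mem_pow_succ ht2 hSu 1 h2
  · -- chart `z`: the unit ideal
    exfalso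
    have hfac := map_window_eq_chart_two ψ (hrel 0) (hrel 1) (show 2 ≤ 3 by norm_num) a (d := 3)
    rw [show 3 - 2 = 1 from rfl, pow_one] at hfac
    have hG := hGm2 _ hfac
    have hu := isUnit_chart_two_cofactor ht (show 2 < 3 by norm_num)
      (S := ∑ k ∈ Finset.range (3 + 1), ψ (a k) * alg (chartGen c 2 0) ^ (3 - k) * alg (chartGen c 2 1) ^ k)
    rw [show 3 - 2 = 1 from rfl, pow_one] at hu
    exact (maximalIdeal.isMaximal L).ne_top (Ideal.eq_top_of_isUnit_mem _ (Ideal.pow_le_self two_ne_zero hG) hu)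

/-! ## 2. Scheme level: any chart presentation of a singular point over the centre is the origin of the chart `x` -/

section Local

variable {X X' : Scheme.{u}} {π : X' ⟶ X}

set_option maxHeartbeats 800000 in
-- the chart rings over `CommRingCat.of` stalks elaborate large terms (as in the tree's `IsBlowup.exists_chart_morphism`)
/-- **For ANY chart presentation `q : Spec B_j → X′` through a point `x′` over a centre point `s` whose window ideal is in cube
normal form** (`𝓘_{Y,s} = 𝔪_s = (c₀, c₁, c₂)`, `J_s = (c₂² + Σ a_k c₀^{3−k} c₁^k)`, `a₃` a unit, `a₀, a₁, a₂ ∈ 𝔪_s`), if the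
controlled transform `(J𝒪 : 𝓘_Y²)` has order `≥ 2` at `x′` then `j = 0`, the prime of `x′` contains `c₁/c₀` and `c₂/c₀`, and it
lies over `𝔪_s` — `x′` is the origin of the chart `t = c₀` (`chart_eq_zero_of_normalForm` run on the presentation, via the tree's
`exists_stalk_ringHom_of_chart`). [cite: StacksProject, Tag 0804] -/
theorem chartIndex_eq_zero_of_le_two [IsLocallyNoetherian X'] {Y : Closeds X} {J : X.IdealSheafData} {s : X} {x' : X'}
    (hx : π x' = s) [IsRegularLocalRing (X.presheaf.stalk s)] (hdim : (maximalIdeal (X.presheaf.stalk s)).spanFinrank = 3)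
    (c : Fin 3 → X.presheaf.stalk s) (hc : Ideal.span (Set.range c) = maximalIdeal _)
    (hY : stalkIdeal (vanishingIdeal Y) s = maximalIdeal _) (a : ℕ → X.presheaf.stalk s) (ha3 : IsUnit (a 3))
    (ha : ∀ j < 3, a j ∈ maximalIdeal _)
    (hJ : stalkIdeal J s = Ideal.span {c 2 ^ 2 + ∑ k ∈ Finset.range (3 + 1), a k * c 0 ^ (3 - k) * c 1 ^ k})
    (j : Fin 3) (q : Spec (.of (chartRing c j)) ⟶ X') (w : Spec (.of (chartRing c j))) (hq : q w = x')
    [IsIso (q.stalkMap w)]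
    (hsq : q ≫ π = Spec.map (CommRingCat.ofHom (chartBase c j)) ≫ X.fromSpecStalk s)
    (hle : (2 : ℕ∞) ≤ idealOrder (controlledTransform π (vanishingIdeal Y) J 2) x') :
    j = 0 ∧ (∀ l, l ≠ j → chartGen c j l ∈ w.asIdeal) ∧
      w.asIdeal.comap (chartBase c j) = maximalIdeal (X.presheaf.stalk s) := by
  classical
  subst hx
  obtain ⟨χ, hχ₀, hloc, h𝔴⟩ :=
    exists_stalk_ringHom_of_chart π x' (CommRingCat.ofHom (chartBase c j)) q w hq hsq
  have hχ : ∀ r, χ (chartBase c j r) = (π.stalkMap x').hom r := fun r => hχ₀ r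
  have h𝔴' : w.asIdeal.comap (chartBase c j) = maximalIdeal (X.presheaf.stalk (π x')) := h𝔴
  clear hχ₀ h𝔴
  letI := χ.toAlgebra
  haveI : IsLocalization.AtPrime (X'.presheaf.stalk x') w.asIdeal := hloc
  obtain ⟨ψ, hψ⟩ : ∃ ψ : X.presheaf.stalk (π x') →+* X'.presheaf.stalk x', ψ = (π.stalkMap x').hom := ⟨_, rfl⟩
  have hψa : ∀ r, ψ r = (algebraMap (chartRing c j) (X'.presheaf.stalk x') :
      chartRing c j →+* X'.presheaf.stalk x') (chartBase c j r) := fun r => by rw [hψ]; exact (hχ r).symm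
  have hrel : ∀ l, ψ (c l) = ψ (c j) * χ (chartGen c j l) := by
    rw [hψ]; exact stalkMap_apply_eq_mul_chartGen j χ hχ
  have hcY : Ideal.span (Set.range c) = stalkIdeal (vanishingIdeal Y) (π x') := hc.trans hY.symm
  have hCmap : (stalkIdeal (vanishingIdeal Y) (π x')).map ψ = Ideal.span {ψ (c j)} := by
    rw [← hcY, Ideal.map_span_range_eq_span_singleton _ c j _ hrel]
  have hstalk : stalkIdeal (controlledTransform π (vanishingIdeal Y) J 2) x' =
      Submodule.colon (Ideal.span {ψ (c 2 ^ 2 + ∑ k ∈ Finset.range (3 + 1), a k * c 0 ^ (3 - k) * c 1 ^ k)})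
        ((Ideal.span {ψ (c j)} ^ 2 : Ideal _) : Set _) := by
    rw [controlledTransform, stalkIdeal_colon, stalkIdeal_pow, stalkIdeal_comap_eq_map_stalkMap,
      stalkIdeal_comap_eq_map_stalkMap, ← hψ, hCmap, hJ, Ideal.map_span, Set.image_singleton]
  have hsing : Submodule.colon (Ideal.span {ψ (c 2 ^ 2 + ∑ k ∈ Finset.range (3 + 1), a k * c 0 ^ (3 - k) * c 1 ^ k)})
      ((Ideal.span {ψ (c j)} ^ 2 : Ideal _) : Set _) ≤ maximalIdeal (X'.presheaf.stalk x') ^ 2 := by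
    rw [← hstalk]; exact (le_idealOrder_iff _ x' 2).mp hle
  obtain ⟨hj, hmem⟩ := chart_eq_zero_of_normalForm hdim c hc a ha3 ha j w.asIdeal h𝔴' (X'.presheaf.stalk x') ψ hψa hsing
  exact ⟨hj, hmem, h𝔴'⟩

end Local

end MohWindowSurface

/-! ## 3. The campaign regime at `p = 2`: fibre uniqueness over an admitted centre -/

section Campaign

variable {K : Type u} [Field K] [CharP K 2]
variable {A A' : AmbientDatum 2 K} {E : IdealExponent A.Z}

/-- **[OURS · L1 W4.6 rung (iii-2), `p = 2`] OVER AN ADMITTED CENTRE THE TRANSFORM HAS AT MOST ONE SINGULAR POINT.** Let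
`π : Z′ → Z` be a §2.1-permissible blow-up of a state `(A, E)` of `Regime.mohWindowSurface` (`p = 2`) whose transform is again in
the regime. Then any two points `x₁, x₂ ∈ Sing(E′)` over the centre are EQUAL. Proof: the centre is a single closed point `ξ`
with a coefficient window presentation whose residue cubic is a cube at every prime (`cube_factor_of_transform_mem`); in its cube
normal form `(x′, y′, z)` (`exists_cube_normal_form`) every singular point over `ξ` is the origin of the chart `t = x′` of ONE chart
family (`IsBlowup.exists_chartFamily`, `chartIndex_eq_zero_of_le_two`), and that origin is one prime
(`Cusp.chartPrime_eq_of_forall_mem`). NOT a statement of the manuscript. [folklore] -/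
theorem eq_of_mem_sing_of_over_centre {D : Closeds A.Z} (π : A'.Z ⟶ A.Z) (hπ : IsBlowup π (vanishingIdeal D))
    (hD : E.IsPermissibleCentre A.hom D) (hRg : Regime.mohWindowSurface A E)
    (hRg' : Regime.mohWindowSurface A' (E.transform π D)) {x₁ x₂ : A'.Z}
    (hx₁ : x₁ ∈ (E.transform π D).sing) (hx₂ : x₂ ∈ (E.transform π D).sing)
    (ho₁ : π.base x₁ ∈ (D : Set A.Z)) (ho₂ : π.base x₂ ∈ (D : Set A.Z)) : x₁ = x₂ := by
  classical
  have hRg0 := hRg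
  obtain ⟨ξ, hξS, hξcl, hDξ⟩ := IsPermissibleCentre.exists_eq_singleton_of_isolatedSing hD ⟨hRg.2.1, hRg.2.2.1⟩
  have hπ1 : π.base x₁ = ξ := by simpa [hDξ] using ho₁
  have hπ2 : π.base x₂ = ξ := by simpa [hDξ] using ho₂
  have hξD : ξ ∈ (D : Set A.Z) := by rw [hDξ]; exact Set.mem_singleton ξ
  obtain ⟨hb, -, -, hwin⟩ := hRg
  haveI : IsLocallyNoetherian A'.Z := by
    haveI := A'.smooth
    exact LocallyOfFiniteType.isLocallyNoetherian A'.hom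
  -- the presentation at the centre, in cube normal form
  obtain ⟨hRreg, h3, x, y, z, hxyz, d, a, hbd, hd2, hunit, hJ⟩ := hwin ξ hξS
  rw [hb] at hbd hd2 hJ
  obtain rfl : d = 3 := by omega
  haveI := hRreg
  obtain ⟨hfac0, -⟩ := cube_factor_of_transform_mem π hπ hD hRg0 hRg' hξD hxyz a hunit hJ
  obtain ⟨x', y', a', hxyz', ha3, ha', hsum⟩ := MohWindowSurface.exists_cube_normal_form hxyz a hunit hfac0
  rw [hsum] at hJ
  -- one chart family for all points over `ξ`
  set c : Fin 3 → A.Z.presheaf.stalk ξ := ![x', y', z] with hc_def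
  have hc : Ideal.span (Set.range c) = maximalIdeal _ := by rw [hc_def, MohWindowSurface.range_vec3]; exact hxyz'
  have hY : stalkIdeal (vanishingIdeal D) ξ = maximalIdeal (A.Z.presheaf.stalk ξ) := by
    apply stalkIdeal_vanishingIdeal_eq_maximalIdeal_of_closure_eq
    rw [hDξ, hξcl.closure_eq]
  have hcY : Ideal.span (Set.range c) = stalkIdeal (vanishingIdeal D) ξ := hc.trans hY.symm
  obtain ⟨q, hq, hpts⟩ := hπ.exists_chartFamily ξ c hcY
  have hJc : stalkIdeal E.J ξ = Ideal.span {c 2 ^ 2 + ∑ k ∈ Finset.range (3 + 1), a' k * c 0 ^ (3 - k) * c 1 ^ k} := by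
    rw [hJ, hc_def]; rfl
  -- every singular point over `ξ` is the origin of the chart `0`
  have key : ∀ x'' : A'.Z, x'' ∈ (E.transform π D).sing → π.base x'' = ξ →
      ∃ w : Spec (.of (chartRing c 0)), (∀ l, l ≠ (0 : Fin 3) → chartGen c 0 l ∈ w.asIdeal) ∧
        w.asIdeal.comap (chartBase c 0) = maximalIdeal (A.Z.presheaf.stalk ξ) ∧ q 0 w = x'' := by
    intro x'' hx'' hπx
    obtain ⟨j, w, hqw, hiso⟩ := hpts x'' hπx
    have hle : (2 : ℕ∞) ≤ idealOrder (controlledTransform π (vanishingIdeal D) E.J 2) x'' := by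
      have := hx''
      simp only [IdealExponent.sing, IdealExponent.transform, Set.mem_setOf_eq, hb] at this
      exact_mod_cast this
    haveI := hiso
    obtain ⟨hj0, hmem, hcomap⟩ := MohWindowSurface.chartIndex_eq_zero_of_le_two (π := π) hπx h3 c hc hY a' ha3 ha' hJc j
      (q j) w hqw (hq j) hle
    subst hj0
    exact ⟨w, hmem, hcomap, hqw⟩
  obtain ⟨w₁, hm₁, hc₁, hq₁⟩ := key x₁ hx₁ hπ1
  obtain ⟨w₂, hm₂, hc₂, hq₂⟩ := key x₂ hx₂ hπ2
  have hw : w₁ = w₂ :=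
    PrimeSpectrum.ext (Cusp.chartPrime_eq_of_forall_mem h3 c hc 0 w₁.asIdeal w₂.asIdeal hc₁ hc₂ hm₁ hm₂)
  rw [← hq₁, ← hq₂, hw]

/-- **The singular locus over an admitted centre is a subsingleton** (set form of `eq_of_mem_sing_of_over_centre`). [folklore] -/
theorem sing_inter_preimage_centre_subsingleton {D : Closeds A.Z} (π : A'.Z ⟶ A.Z) (hπ : IsBlowup π (vanishingIdeal D))
    (hD : E.IsPermissibleCentre A.hom D) (hRg : Regime.mohWindowSurface A E)
    (hRg' : Regime.mohWindowSurface A' (E.transform π D)) :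
    ((E.transform π D).sing ∩ π.base ⁻¹' (D : Set A.Z)).Subsingleton :=
  fun _ h₁ _ h₂ => eq_of_mem_sing_of_over_centre π hπ hD hRg hRg' h₁.1 h₂.1 h₁.2 h₂.2

end Campaign

end CampaignW46

end Summit.ResolutionOfSingularities.ResolutionOfSingularities.Theorems

end
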